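import Mathlib
import Literature.NumberTheory.LFunctions.Zhang2022.Section15CU055LData
import HarnessLib

/-!
# `ζ(s)` near `s = 1` to first order, and the Taylor data at `z = 0` of the §16 residue factor
# `M(z) = ζ(1+z−βⱼ)·L(1+z,χ)·L(1+z−βⱼ,χ)²` (Zhang (2022) §16 p. 94, the step "the contour of integration
# is moved in the same way as in the proof of Lemma 8.4 … = L′(1,χ)³𝔲₂ⱼ(1) + O(1/𝓛⁴)", tex L4662–L4664,
# at the repaired normaliser of row G-d57-1)

Topic `Literature/NumberTheory/LFunctions/Zhang2022` (Landau–Siegel audit tree; verdict-neutral).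
Y. Zhang, *Discrete mean estimates and the Landau–Siegel zero*, arXiv:2211.02515v1 (2022)
[Zhang2022LandauSiegel] — **an unrefereed manuscript under adjudication**; nothing here asserts or denies
its Theorems 1–2, and no display of the manuscript is asserted. In the repaired reading of §16 p. 94
(`Typed.Section16B.Step16_u041aR`, ZHANG-L WP16 block C) the integrand
`ζ(1+s)²·ζ(1+s−βⱼ)L(1+s,χ)L(1+s−βⱼ,χ)²·E₂ⱼ(1+s)·Tˢω₁(s)/s` has a triple pole at `s = 0`; its residue is
`½φ″(0)` for `φ(z) = ζ₁(1+z)²·(M(z)·E₂ⱼ(1+z))·Tᶻω₁(z)` (`U055.residue_triple_eq`, zl-w15-p2's generic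
§15 analysis, `Section15CU055Residue`), and the character-side factor is
`M(z) = ζ(1+z−βⱼ)·L(1+z,χ)·L(1+z−βⱼ,χ)²` — analytic at `0` (the pole of `ζ(1+z−βⱼ)` sits at
`z = βⱼ ≠ 0`) but NOT on a ball of radius `1/𝓛` (`|βⱼ| < 5α`). This file controls the Taylor data of
`M` at `0` from TREE THEOREMS only: `ζ(s) = (s−1)⁻¹ζ₁(s)` with Mathlib's entire `riemannZeta₁`
(`ζ₁(1) = 1`; `‖ζ(1+u) − u⁻¹‖ ≤ K`, `‖ζ′(1+u) + u⁻²‖ ≤ 2K/|u|` for `0 < |u| ≤ 1/4`, from a compactness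
bound and Cauchy's estimate), the `L`-data near `1` of `Section15CU055LData` / `Section3Lemma31`
(`L(1−β) = L(1) − βL′(1) + O(𝓛³|β|²)`, `L′(1−β) = L′(1) + O(𝓛³|β|)`, `‖L″‖ ≤ 64e^{9/2}(1+𝓛)𝓛²` near `1`),
`α/2 ≤ |βⱼ| < 5α` (`Ded1524.betaJ_norm_lt` and `betaJ_norm_ge` below), and Assumption (A)
`‖L(1,χ)‖ < 𝓛⁻²⁰²²`:

* `exists_zeta1_near_one_consts`, `norm_zeta_sub_inv_le`, `norm_deriv_zeta_add_inv_sq_le` — `ζ` near `1`;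
* `zetaLsq_data` — `A(z) = ζ(1+z−β)L(1+z−β,χ)²`: holomorphy off `z = β`, `A(0)`, `A′(0)`;
  `norm_deriv_zetaLsq_sub_sq_le` — the KEY identity/size: `A′(0) = L′(1,χ)² + (explicit small terms)`;
  `norm_zetaLsq_le_on_ball`, `norm_iteratedDeriv_two_zetaLsq_le` — crude Cauchy control of `A″(0)`;
* `resFactor_data` — `M = A·L(1+·,χ)`: analyticity at `0` and the Leibniz formulas;
* `resFactor_bounds` — **for all large `D`, under (A), `j ∈ {1,2,3}`** (`ℓ = ‖L′(1,χ)‖`):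
  `‖M(0)‖ ≤ Cα⁴(1+ℓ)²`, `‖M′(0)‖ ≤ Cα(1+ℓ)³`, `‖½M″(0) − L′(1,χ)³‖ ≤ Cα𝓛³(1+ℓ)³`.

With `S = sup_{|z|<1/𝓛}‖E₂ⱼ(1+z)‖`, `r = 1/𝓛`, `Y = T` these feed `U055.norm_residue_triple_sub_le`-type
bookkeeping to give `Res_{s=0} = L′(1,χ)³E₂ⱼ(1) + O(α𝓛^{4.1}(1+ℓ)³S)`. Reading-independent. WHAT THIS IS
NOT: a proof of u041a in any reading; the bound on `E₂ⱼ` near `1` is Lemma 16.2's business (block D).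

## References
* Y. Zhang, arXiv:2211.02515v1 (2022), §16 p. 94, tex L4655–L4665; §5 Lemma 5.8 p. 24 (`L` near `1`).
  [cite: Zhang2022LandauSiegel, §16 p.94]
* E. C. Titchmarsh, *The Theory of the Riemann Zeta-Function*, 2nd ed. (1986), §2.1 (2.1.16)
  (`ζ(s) − 1/(s−1)` regular at `1`). [cite: Titchmarsh1986, §2.1]
-/

noncomputable section

open Complex Real Set Filter Topology Metric

namespace Literature.NumberTheory.LFunctions.Zhang2022.U041

open Literature.NumberTheory.LFunctions.Zhang2022.Skeleton

/-! ### `ζ` near `1`: `ζ(1+u) = u⁻¹ + O(1)`, `ζ′(1+u) = −u⁻² + O(|u|⁻¹)` -/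

section ZetaNearOne

/-- **Constants for `ζ₁` near `1`**: there is `K ≥ 1` with `‖ζ₁(1+u)‖ ≤ K`, `‖ζ₁(1+u) − 1‖ ≤ K‖u‖`
and `‖ζ₁′(1+u)‖ ≤ K` for `‖u‖ ≤ 1/4` (`ζ₁` = Mathlib's entire `riemannZeta₁ = (s−1)ζ(s)`, `ζ₁(1) = 1`;
compactness on `|w−1| ≤ 1`, Cauchy's estimate and the Lipschitz bound on balls).
[cite: Titchmarsh1986, §2.1] -/
theorem exists_zeta1_near_one_consts : ∃ K : ℝ, 1 ≤ K ∧ ∀ u : ℂ, ‖u‖ ≤ 1 / 4 →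
    ‖riemannZeta₁ (1 + u)‖ ≤ K ∧ ‖riemannZeta₁ (1 + u) - 1‖ ≤ K * ‖u‖ ∧
      ‖deriv riemannZeta₁ (1 + u)‖ ≤ K := by
  obtain ⟨K₀, hK₀⟩ := (isCompact_closedBall (1 : ℂ) 1).exists_bound_of_continuousOn
    differentiable_riemannZeta₁.continuous.continuousOn
  have hK₀0 : 0 ≤ K₀ := (norm_nonneg _).trans (hK₀ 1 (mem_closedBall_self (by norm_num)))
  refine ⟨4 * K₀ + 1, by linarith, fun u hu => ?_⟩
  have hd : DifferentiableOn ℂ riemannZeta₁ (ball (1 : ℂ) 1) :=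
    differentiable_riemannZeta₁.differentiableOn
  have hM : ∀ z ∈ ball (1 : ℂ) 1, ‖riemannZeta₁ z‖ ≤ K₀ := fun z hz => hK₀ z (ball_subset_closedBall hz)
  have hmem : (1 : ℂ) + u ∈ closedBall (1 : ℂ) 1 := by
    rw [mem_closedBall, dist_eq_norm, add_sub_cancel_left]; linarith
  refine ⟨(hK₀ _ hmem).trans (by linarith), ?_, ?_⟩
  · -- Lipschitz on `ball 1 (1/2)`
    have hz : (1 : ℂ) + u ∈ ball (1 : ℂ) (1 / 2) := by
      rw [mem_ball, dist_eq_norm, add_sub_cancel_left]; linarith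
    have hw : (1 : ℂ) ∈ ball (1 : ℂ) (1 / 2) := mem_ball_self (by norm_num)
    have h := Literature.Analysis.Complex.norm_sub_le_mul_of_forall_mem_ball one_pos hd hM hz hw
    rw [riemannZeta₁_one, add_sub_cancel_left] at h
    calc ‖riemannZeta₁ (1 + u) - 1‖ ≤ 4 * K₀ / 1 * ‖u‖ := h
      _ ≤ (4 * K₀ + 1) * ‖u‖ := by
          rw [div_one]; exact mul_le_mul_of_nonneg_right (by linarith) (norm_nonneg _)
  · -- Cauchy's estimate on `ball (1+u) (1/2) ⊆ closedBall 1 1`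
    have hd' : DifferentiableOn ℂ riemannZeta₁ (ball ((1 : ℂ) + u) (1 / 2)) :=
      differentiable_riemannZeta₁.differentiableOn
    have hM' : ∀ z ∈ ball ((1 : ℂ) + u) (1 / 2), ‖riemannZeta₁ z‖ ≤ K₀ := by
      intro z hz
      refine hK₀ z ?_
      rw [mem_ball, dist_eq_norm] at hz
      rw [mem_closedBall, dist_eq_norm]
      calc ‖z - 1‖ = ‖(z - (1 + u)) + u‖ := by ring_nf
        _ ≤ ‖z - (1 + u)‖ + ‖u‖ := norm_add_le _ _
        _ ≤ 1 / 2 + 1 / 4 := add_le_add hz.le hu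
        _ ≤ 1 := by norm_num
    have h := Literature.Analysis.Complex.norm_deriv_le_of_forall_mem_ball (by norm_num) hd' hM'
    calc ‖deriv riemannZeta₁ (1 + u)‖ ≤ 2 * K₀ / (1 / 2) := h
      _ = 4 * K₀ := by ring
      _ ≤ 4 * K₀ + 1 := by linarith

/-- **`ζ(1+u) = u⁻¹ + O(1)`**: for `0 < ‖u‖ ≤ 1/4`, `‖ζ(1+u) − u⁻¹‖ ≤ K` (with the constant of
`exists_zeta1_near_one_consts`: `ζ(1+u) − u⁻¹ = u⁻¹(ζ₁(1+u) − 1)`). [cite: Titchmarsh1986, §2.1] -/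
theorem norm_zeta_sub_inv_le {K : ℝ}
    (hK : ∀ u : ℂ, ‖u‖ ≤ 1 / 4 → ‖riemannZeta₁ (1 + u)‖ ≤ K ∧ ‖riemannZeta₁ (1 + u) - 1‖ ≤ K * ‖u‖ ∧
      ‖deriv riemannZeta₁ (1 + u)‖ ≤ K)
    {u : ℂ} (hu0 : u ≠ 0) (hu : ‖u‖ ≤ 1 / 4) :
    ‖riemannZeta (1 + u) - u⁻¹‖ ≤ K := by
  have h1 : (1 : ℂ) + u ≠ 1 := by intro h; apply hu0; linear_combination h
  rw [riemannZeta_eq_inv_sub_mul h1, add_sub_cancel_left]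
  have e : u⁻¹ * riemannZeta₁ (1 + u) - u⁻¹ = u⁻¹ * (riemannZeta₁ (1 + u) - 1) := by ring
  rw [e, norm_mul, norm_inv]
  have hupos : 0 < ‖u‖ := norm_pos_iff.mpr hu0
  calc ‖u‖⁻¹ * ‖riemannZeta₁ (1 + u) - 1‖ ≤ ‖u‖⁻¹ * (K * ‖u‖) :=
        mul_le_mul_of_nonneg_left (hK u hu).2.1 (inv_nonneg.mpr hupos.le)
    _ = K := by field_simp

/-- **`ζ′(1+u) = −u⁻² + O(|u|⁻¹)`**: for `0 < ‖u‖ ≤ 1/4`, `‖ζ′(1+u) + u⁻²‖ ≤ 2K/‖u‖`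
(`ζ′(s) = −(s−1)⁻²ζ₁(s) + (s−1)⁻¹ζ₁′(s)`, Mathlib `deriv_riemannZeta_eq_neg_inv_sub_sq_mul_add`).
[cite: Titchmarsh1986, §2.1] -/
theorem norm_deriv_zeta_add_inv_sq_le {K : ℝ}
    (hK : ∀ u : ℂ, ‖u‖ ≤ 1 / 4 → ‖riemannZeta₁ (1 + u)‖ ≤ K ∧ ‖riemannZeta₁ (1 + u) - 1‖ ≤ K * ‖u‖ ∧
      ‖deriv riemannZeta₁ (1 + u)‖ ≤ K)
    {u : ℂ} (hu0 : u ≠ 0) (hu : ‖u‖ ≤ 1 / 4) :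
    ‖deriv riemannZeta (1 + u) + (u⁻¹) ^ 2‖ ≤ 2 * K / ‖u‖ := by
  have h1 : (1 : ℂ) + u ≠ 1 := by intro h; apply hu0; linear_combination h
  rw [deriv_riemannZeta_eq_neg_inv_sub_sq_mul_add h1, add_sub_cancel_left]
  have e : -(u⁻¹) ^ 2 * riemannZeta₁ (1 + u) + u⁻¹ * deriv riemannZeta₁ (1 + u) + (u⁻¹) ^ 2 =
      -(u⁻¹) ^ 2 * (riemannZeta₁ (1 + u) - 1) + u⁻¹ * deriv riemannZeta₁ (1 + u) := by ring
  rw [e]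
  have hupos : 0 < ‖u‖ := norm_pos_iff.mpr hu0
  obtain ⟨-, hb, hc⟩ := hK u hu
  calc ‖-(u⁻¹) ^ 2 * (riemannZeta₁ (1 + u) - 1) + u⁻¹ * deriv riemannZeta₁ (1 + u)‖
      ≤ ‖-(u⁻¹) ^ 2 * (riemannZeta₁ (1 + u) - 1)‖ + ‖u⁻¹ * deriv riemannZeta₁ (1 + u)‖ :=
        norm_add_le _ _
    _ = ‖u‖⁻¹ ^ 2 * ‖riemannZeta₁ (1 + u) - 1‖ + ‖u‖⁻¹ * ‖deriv riemannZeta₁ (1 + u)‖ := by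
        rw [norm_mul, norm_mul, norm_neg, norm_pow, norm_inv]
    _ ≤ ‖u‖⁻¹ ^ 2 * (K * ‖u‖) + ‖u‖⁻¹ * K := by gcongr
    _ = 2 * K / ‖u‖ := by field_simp; ring

end ZetaNearOne

/-! ### The factor `A(z) = ζ(1+z−β)·L(1+z−β,χ)²` -/

section ZetaLsq

variable {q : ℕ} [NeZero q] (χ : DirichletCharacter ℂ q)

/-- **`A(z) = ζ(1+z−β)L(1+z−β,χ)²`**: for `χ ≠ 1` (so `L(·,χ)` is entire) and `β ≠ 0`, `A` is complex
differentiable on `{z | z ≠ β}`, `A(0) = ζ(1−β)L(1−β)²` and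
`A′(0) = ζ′(1−β)L(1−β)² + 2ζ(1−β)L(1−β)L′(1−β)`. [cite: Zhang2022LandauSiegel, §16 p.94] -/
theorem zetaLsq_data (hχ1 : χ ≠ 1) {β : ℂ} (hβ : β ≠ 0) :
    DifferentiableOn ℂ (fun z : ℂ => riemannZeta (1 + z - β) * χ.LFunction (1 + z - β) ^ 2)
        {z : ℂ | z ≠ β} ∧
      (fun z : ℂ => riemannZeta (1 + z - β) * χ.LFunction (1 + z - β) ^ 2) 0 =
        riemannZeta (1 - β) * χ.LFunction (1 - β) ^ 2 ∧
      deriv (fun z : ℂ => riemannZeta (1 + z - β) * χ.LFunction (1 + z - β) ^ 2) 0 =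
        deriv riemannZeta (1 - β) * χ.LFunction (1 - β) ^ 2 +
          2 * riemannZeta (1 - β) * χ.LFunction (1 - β) * deriv χ.LFunction (1 - β) := by
  have hL := DirichletCharacter.differentiable_LFunction hχ1
  set F : ℂ → ℂ := fun w => riemannZeta w * χ.LFunction w ^ 2 with hF
  have hAF : (fun z : ℂ => riemannZeta (1 + z - β) * χ.LFunction (1 + z - β) ^ 2) =
      fun z => F ((1 - β) + z) := by
    funext z; simp only [hF]; ring_nf
  refine ⟨?_, ?_, ?_⟩
  · intro z hz
    have hw : (1 : ℂ) + z - β ≠ 1 := by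
      intro h; apply hz; linear_combination h
    exact ((differentiableAt_riemannZeta hw).comp z (by fun_prop) |>.mul
      (((hL _).comp z (by fun_prop)).pow 2)).differentiableWithinAt
  · simp
  · rw [hAF, deriv_comp_const_add]
    simp only [add_zero]
    have h1 : (1 : ℂ) - β ≠ 1 := by
      intro h; apply hβ; linear_combination -h
    simp only [hF]
    have hd : HasDerivAt (fun w : ℂ => riemannZeta w * χ.LFunction w ^ 2)
        (deriv riemannZeta (1 - β) * χ.LFunction (1 - β) ^ 2 +
          riemannZeta (1 - β) * ((2 : ℕ) * χ.LFunction (1 - β) ^ (2 - 1) *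
            deriv χ.LFunction (1 - β))) (1 - β) :=
      (differentiableAt_riemannZeta h1).hasDerivAt.mul ((hL _).hasDerivAt.fun_pow 2)
    rw [hd.deriv]
    simp only [Nat.cast_ofNat, Nat.add_one_sub_one, pow_one]
    ring

/-- **The algebra of `A′(0) − L′(1,χ)²`**: for complex numbers `Z₀, Z₁, λ₀, λ₁, L₁` and `u ≠ 0`, with
`θ₀ = Z₀ − u⁻¹`, `θ₁ = Z₁ + u⁻²`, `ε₁ = λ₀ − uL₁`, `ε₂ = λ₁ − L₁`:
`Z₁λ₀² + 2Z₀λ₀λ₁ − L₁² = 2L₁ε₂ + 2ε₁ε₂u⁻¹ − ε₁²u⁻² + θ₁λ₀² + 2θ₀λ₀λ₁` (in the application `u = −β`,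
`Z₀ = ζ(1−β)`, `Z₁ = ζ′(1−β)`, `λ₀ = L(1−β,χ)`, `λ₁ = L′(1−β,χ)`, `L₁ = L′(1,χ)`: the main terms `−L₁²`
from `ζ′λ₀²` and `+2L₁²` from `2ζλ₀λ₁` combine to `L₁²`). [folklore] -/
private theorem zetaLsq_deriv_algebra (Z₀ Z₁ l₀ l₁ L₁ u : ℂ) (hu : u ≠ 0) :
    Z₁ * l₀ ^ 2 + 2 * Z₀ * l₀ * l₁ - L₁ ^ 2 =
      2 * L₁ * (l₁ - L₁) + 2 * (l₀ - u * L₁) * (l₁ - L₁) * u⁻¹ - (l₀ - u * L₁) ^ 2 * (u⁻¹) ^ 2 +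
        (Z₁ + (u⁻¹) ^ 2) * l₀ ^ 2 + 2 * (Z₀ - u⁻¹) * l₀ * l₁ := by
  field_simp
  ring

/-- **Size of `A(0)` and of `A′(0) − L′(1,χ)²`** (`A(z) = ζ(1+z−β)L(1+z−β,χ)²`, `χ ≠ 1`, `0 < ‖β‖ ≤ 1/4`,
`K` the constant of `exists_zeta1_near_one_consts`), in terms of `λ₀ = ‖L(1−β,χ)‖`, `λ₁ = ‖L′(1−β,χ)‖`,
`ℓ = ‖L′(1,χ)‖`, `e₁ = ‖L(1−β,χ) + βL′(1,χ)‖`, `e₂ = ‖L′(1−β,χ) − L′(1,χ)‖`: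
`‖A(0)‖ ≤ (‖β‖⁻¹ + K)λ₀²` and
`‖A′(0) − L′(1,χ)²‖ ≤ 2ℓe₂ + 2e₁e₂‖β‖⁻¹ + e₁²‖β‖⁻² + (2K/‖β‖)λ₀² + 2Kλ₀λ₁`.
[cite: Zhang2022LandauSiegel, §16 p.94] -/
theorem norm_zetaLsq_data_le {K : ℝ}
    (hK : ∀ u : ℂ, ‖u‖ ≤ 1 / 4 → ‖riemannZeta₁ (1 + u)‖ ≤ K ∧ ‖riemannZeta₁ (1 + u) - 1‖ ≤ K * ‖u‖ ∧
      ‖deriv riemannZeta₁ (1 + u)‖ ≤ K)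
    (hχ1 : χ ≠ 1) {β : ℂ} (hβ : β ≠ 0) (hβ4 : ‖β‖ ≤ 1 / 4) :
    ‖(fun z : ℂ => riemannZeta (1 + z - β) * χ.LFunction (1 + z - β) ^ 2) 0‖ ≤
        (‖β‖⁻¹ + K) * ‖χ.LFunction (1 - β)‖ ^ 2 ∧
      ‖deriv (fun z : ℂ => riemannZeta (1 + z - β) * χ.LFunction (1 + z - β) ^ 2) 0 -
          deriv χ.LFunction 1 ^ 2‖ ≤
        2 * ‖deriv χ.LFunction 1‖ * ‖deriv χ.LFunction (1 - β) - deriv χ.LFunction 1‖ +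
          2 * ‖χ.LFunction (1 - β) + β * deriv χ.LFunction 1‖ *
            ‖deriv χ.LFunction (1 - β) - deriv χ.LFunction 1‖ * ‖β‖⁻¹ +
          ‖χ.LFunction (1 - β) + β * deriv χ.LFunction 1‖ ^ 2 * ‖β‖⁻¹ ^ 2 +
          2 * K / ‖β‖ * ‖χ.LFunction (1 - β)‖ ^ 2 +
          2 * K * ‖χ.LFunction (1 - β)‖ * ‖deriv χ.LFunction (1 - β)‖ := by
  obtain ⟨-, hA0, hA1⟩ := zetaLsq_data χ hχ1 hβ
  have hu0 : (-β : ℂ) ≠ 0 := neg_ne_zero.mpr hβ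
  have hu4 : ‖(-β : ℂ)‖ ≤ 1 / 4 := by rwa [norm_neg]
  have hZ0 := norm_zeta_sub_inv_le hK hu0 hu4
  have hZ1 := norm_deriv_zeta_add_inv_sq_le hK hu0 hu4
  rw [show (1 : ℂ) + -β = 1 - β by ring] at hZ0 hZ1
  rw [norm_neg] at hZ1
  have hb : 0 < ‖β‖ := norm_pos_iff.mpr hβ
  constructor
  · rw [hA0, norm_mul, norm_pow]
    refine mul_le_mul_of_nonneg_right ?_ (by positivity)
    calc ‖riemannZeta (1 - β)‖ = ‖(riemannZeta (1 - β) - (-β)⁻¹) + (-β)⁻¹‖ := by rw [sub_add_cancel]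
      _ ≤ ‖riemannZeta (1 - β) - (-β)⁻¹‖ + ‖(-β : ℂ)⁻¹‖ := norm_add_le _ _
      _ ≤ K + ‖β‖⁻¹ := by rw [norm_inv, norm_neg]; exact add_le_add hZ0 le_rfl
      _ = ‖β‖⁻¹ + K := add_comm _ _
  · rw [hA1]
    set Z₀ := riemannZeta (1 - β)
    set Z₁ := deriv riemannZeta (1 - β)
    set l₀ := χ.LFunction (1 - β)
    set l₁ := deriv χ.LFunction (1 - β)
    set L₁ := deriv χ.LFunction 1
    have e : Z₁ * l₀ ^ 2 + 2 * Z₀ * l₀ * l₁ - L₁ ^ 2 =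
        2 * L₁ * (l₁ - L₁) + 2 * (l₀ - (-β) * L₁) * (l₁ - L₁) * (-β)⁻¹ -
          (l₀ - (-β) * L₁) ^ 2 * ((-β)⁻¹) ^ 2 +
          (Z₁ + ((-β)⁻¹) ^ 2) * l₀ ^ 2 + 2 * (Z₀ - (-β)⁻¹) * l₀ * l₁ :=
      zetaLsq_deriv_algebra Z₀ Z₁ l₀ l₁ L₁ (-β) hu0
    rw [e]
    have hε : l₀ - (-β) * L₁ = l₀ + β * L₁ := by ring
    rw [hε]
    have hnb : ‖(-β : ℂ)⁻¹‖ = ‖β‖⁻¹ := by rw [norm_inv, norm_neg]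
    calc _ ≤ ‖2 * L₁ * (l₁ - L₁)‖ + ‖2 * (l₀ + β * L₁) * (l₁ - L₁) * (-β)⁻¹‖ +
          ‖(l₀ + β * L₁) ^ 2 * ((-β)⁻¹) ^ 2‖ + ‖(Z₁ + ((-β)⁻¹) ^ 2) * l₀ ^ 2‖ +
          ‖2 * (Z₀ - (-β)⁻¹) * l₀ * l₁‖ := by
          refine (norm_add_le _ _).trans ?_
          gcongr
          refine (norm_add_le _ _).trans ?_
          gcongr
          refine (norm_sub_le _ _).trans ?_
          gcongr
          exact norm_add_le _ _
      _ ≤ _ := by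
          simp only [norm_mul, norm_pow, Complex.norm_two, hnb]
          gcongr

/-- **`A` on the ball `|z| < ‖β‖/2`**: for `χ` primitive mod `q`, `log q ≥ 3`, `0 < ‖β‖ ≤ 1/(4 log q)`
(so `‖β‖ ≤ 1/12`) and `‖z‖ < ‖β‖/2`, with `u = z − β` (`‖β‖/2 ≤ ‖u‖ ≤ 3‖β‖/2`):
`‖A(z)‖ ≤ (2/‖β‖ + K)·(‖L(1,χ)‖ + 12e^{9/2}(1+log q)(log q)‖β‖)²` (`ζ(1+u) = u⁻¹ + O(1)`; `L(1+u) = L(1)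
+ O((1+log q)log q·|u|)` by the Lipschitz bound from `‖L‖ ≤ 2e^{9/2}(1+log q)` on `|w−1| < 1/log q`).
[cite: Zhang2022LandauSiegel, §16 p.94] -/
theorem norm_zetaLsq_le_on_ball {K : ℝ}
    (hK : ∀ u : ℂ, ‖u‖ ≤ 1 / 4 → ‖riemannZeta₁ (1 + u)‖ ≤ K ∧ ‖riemannZeta₁ (1 + u) - 1‖ ≤ K * ‖u‖ ∧
      ‖deriv riemannZeta₁ (1 + u)‖ ≤ K)
    (hq : 3 ≤ Real.log q) (hχ : χ.IsPrimitive) {β : ℂ} (hβ : β ≠ 0)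
    (hβq : ‖β‖ ≤ 1 / (4 * Real.log q)) {z : ℂ} (hz : z ∈ ball (0 : ℂ) (‖β‖ / 2)) :
    ‖riemannZeta (1 + z - β) * χ.LFunction (1 + z - β) ^ 2‖ ≤
      (2 / ‖β‖ + K) * (‖χ.LFunction 1‖ + 12 * Real.exp (9 / 2) * (1 + Real.log q) * Real.log q * ‖β‖) ^ 2 := by
  have hq2 : 2 ≤ q := by
    rcases Nat.lt_or_ge q 2 with h | h
    · interval_cases q <;> norm_num at hq
    · exact h
  set Lq : ℝ := Real.log q with hL
  have hL0 : 0 < Lq := by linarith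
  have hχ1 := Lemma31.ne_one_of_isPrimitive χ hq2 hχ
  have hb : 0 < ‖β‖ := norm_pos_iff.mpr hβ
  rw [mem_ball_zero_iff] at hz
  -- `‖β‖ ≤ 1/12`
  have hβ12 : ‖β‖ ≤ 1 / 12 := hβq.trans (by
    rw [div_le_div_iff₀ (by positivity) (by norm_num)]; linarith only [hq])
  set u : ℂ := z - β with hudef
  have hzu : (1 : ℂ) + z - β = 1 + u := by simp only [hudef]; ring
  have hu_lo : ‖β‖ / 2 ≤ ‖u‖ := by
    have : ‖β‖ ≤ ‖u‖ + ‖z‖ := by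
      calc ‖β‖ = ‖z - u‖ := by simp only [hudef]; ring_nf
        _ ≤ ‖z‖ + ‖u‖ := norm_sub_le _ _
        _ = ‖u‖ + ‖z‖ := add_comm _ _
    linarith
  have hu_hi : ‖u‖ ≤ 3 * ‖β‖ / 2 := by
    calc ‖u‖ ≤ ‖z‖ + ‖β‖ := norm_sub_le _ _
      _ ≤ 3 * ‖β‖ / 2 := by linarith
  have hu0 : u ≠ 0 := by
    intro h; rw [h, norm_zero] at hu_lo; linarith
  have hu4 : ‖u‖ ≤ 1 / 4 := by linarith
  -- `ζ(1+u)`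
  have hζ : ‖riemannZeta (1 + u)‖ ≤ 2 / ‖β‖ + K := by
    have h1 := norm_zeta_sub_inv_le hK hu0 hu4
    have hupos : 0 < ‖u‖ := norm_pos_iff.mpr hu0
    calc ‖riemannZeta (1 + u)‖ = ‖(riemannZeta (1 + u) - u⁻¹) + u⁻¹‖ := by rw [sub_add_cancel]
      _ ≤ K + ‖u‖⁻¹ := (norm_add_le _ _).trans (by rw [norm_inv]; exact add_le_add h1 le_rfl)
      _ ≤ K + 2 / ‖β‖ := by
          gcongr
          rw [inv_eq_one_div, div_le_div_iff₀ hupos hb]; linarith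
      _ = 2 / ‖β‖ + K := add_comm _ _
  -- `L(1+u)`: Lipschitz on `ball 1 (1/(2Lq))` from the sup bound on `ball 1 (1/Lq)`
  have hR : 0 < 1 / Lq := one_div_pos.2 hL0
  have hd : DifferentiableOn ℂ χ.LFunction (ball 1 (1 / Lq)) :=
    (DirichletCharacter.differentiable_LFunction hχ1).differentiableOn
  have hM : ∀ w ∈ ball (1 : ℂ) (1 / Lq), ‖χ.LFunction w‖ ≤ 2 * Real.exp (9 / 2) * (1 + Lq) := by
    intro w hw
    refine Lemma31.norm_LFunction_le_near_one χ hq hχ ?_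
    rw [mem_ball, dist_eq_norm] at hw
    exact hw.le.trans (div_le_div_of_nonneg_right (by norm_num) hL0.le)
  have hzb : (1 : ℂ) + u ∈ ball (1 : ℂ) (1 / Lq / 2) := by
    rw [mem_ball, dist_eq_norm, add_sub_cancel_left]
    calc ‖u‖ ≤ 3 * ‖β‖ / 2 := hu_hi
      _ ≤ 3 * (1 / (4 * Lq)) / 2 := by gcongr
      _ = 3 / (8 * Lq) := by field_simp; ring
      _ < 4 / (8 * Lq) := div_lt_div_of_pos_right (by norm_num) (by positivity)
      _ = 1 / Lq / 2 := by field_simp; ring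
  have hwb : (1 : ℂ) ∈ ball (1 : ℂ) (1 / Lq / 2) := mem_ball_self (by positivity)
  have hLip := Literature.Analysis.Complex.norm_sub_le_mul_of_forall_mem_ball hR hd hM hzb hwb
  rw [add_sub_cancel_left] at hLip
  have hLu : ‖χ.LFunction (1 + u)‖ ≤
      ‖χ.LFunction 1‖ + 12 * Real.exp (9 / 2) * (1 + Lq) * Lq * ‖β‖ := by
    calc ‖χ.LFunction (1 + u)‖ = ‖χ.LFunction 1 + (χ.LFunction (1 + u) - χ.LFunction 1)‖ := by
          rw [add_sub_cancel]
      _ ≤ ‖χ.LFunction 1‖ + ‖χ.LFunction (1 + u) - χ.LFunction 1‖ := norm_add_le _ _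
      _ ≤ ‖χ.LFunction 1‖ + 4 * (2 * Real.exp (9 / 2) * (1 + Lq)) / (1 / Lq) * ‖u‖ := by
          gcongr
      _ = ‖χ.LFunction 1‖ + 8 * Real.exp (9 / 2) * (1 + Lq) * Lq * ‖u‖ := by
          field_simp
          ring
      _ ≤ ‖χ.LFunction 1‖ + 8 * Real.exp (9 / 2) * (1 + Lq) * Lq * (3 * ‖β‖ / 2) := by gcongr
      _ = ‖χ.LFunction 1‖ + 12 * Real.exp (9 / 2) * (1 + Lq) * Lq * ‖β‖ := by ring
  rw [hzu, norm_mul, norm_pow]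
  have h0 : 0 ≤ ‖χ.LFunction (1 + u)‖ := norm_nonneg _
  have hK0 : 0 ≤ K := by
    have h := (hK 0 (by norm_num)).1
    rw [add_zero, riemannZeta₁_one, norm_one] at h
    linarith
  have hpos : 0 ≤ 2 / ‖β‖ + K := by positivity
  calc ‖riemannZeta (1 + u)‖ * ‖χ.LFunction (1 + u)‖ ^ 2
      ≤ (2 / ‖β‖ + K) * (‖χ.LFunction 1‖ + 12 * Real.exp (9 / 2) * (1 + Lq) * Lq * ‖β‖) ^ 2 :=
        mul_le_mul hζ (pow_le_pow_left₀ h0 hLu 2) (by positivity) hpos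

/-- **Cauchy control of `A″(0)`**: under the hypotheses of `norm_zetaLsq_le_on_ball`,
`‖A″(0)‖ ≤ 32·(2/‖β‖ + K)(‖L(1,χ)‖ + 12e^{9/2}(1+log q)(log q)‖β‖)²/‖β‖²` (Cauchy's estimate on the ball
`|z| < ‖β‖/2`, on which `A` is holomorphic since its only singularity is `z = β`).
[cite: Zhang2022LandauSiegel, §16 p.94] -/
theorem norm_iteratedDeriv_two_zetaLsq_le {K : ℝ}
    (hK : ∀ u : ℂ, ‖u‖ ≤ 1 / 4 → ‖riemannZeta₁ (1 + u)‖ ≤ K ∧ ‖riemannZeta₁ (1 + u) - 1‖ ≤ K * ‖u‖ ∧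
      ‖deriv riemannZeta₁ (1 + u)‖ ≤ K)
    (hq : 3 ≤ Real.log q) (hχ : χ.IsPrimitive) {β : ℂ} (hβ : β ≠ 0)
    (hβq : ‖β‖ ≤ 1 / (4 * Real.log q)) :
    ‖iteratedDeriv 2 (fun z : ℂ => riemannZeta (1 + z - β) * χ.LFunction (1 + z - β) ^ 2) 0‖ ≤
      32 * ((2 / ‖β‖ + K) *
        (‖χ.LFunction 1‖ + 12 * Real.exp (9 / 2) * (1 + Real.log q) * Real.log q * ‖β‖) ^ 2) / ‖β‖ ^ 2 := by
  have hq2 : 2 ≤ q := by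
    rcases Nat.lt_or_ge q 2 with h | h
    · interval_cases q <;> norm_num at hq
    · exact h
  have hχ1 := Lemma31.ne_one_of_isPrimitive χ hq2 hχ
  have hb : 0 < ‖β‖ := norm_pos_iff.mpr hβ
  have hR : 0 < ‖β‖ / 2 := by positivity
  obtain ⟨hdiff, -, -⟩ := zetaLsq_data χ hχ1 hβ
  have hd : DifferentiableOn ℂ (fun z : ℂ => riemannZeta (1 + z - β) * χ.LFunction (1 + z - β) ^ 2)
      (ball (0 : ℂ) (‖β‖ / 2)) := by
    refine hdiff.mono fun z hz => ?_
    rw [mem_ball_zero_iff] at hz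
    intro h
    have : ‖z‖ = ‖β‖ := by rw [h]
    linarith
  have hM : ∀ z ∈ ball (0 : ℂ) (‖β‖ / 2),
      ‖riemannZeta (1 + z - β) * χ.LFunction (1 + z - β) ^ 2‖ ≤
        (2 / ‖β‖ + K) * (‖χ.LFunction 1‖ +
          12 * Real.exp (9 / 2) * (1 + Real.log q) * Real.log q * ‖β‖) ^ 2 :=
    fun z hz => norm_zetaLsq_le_on_ball χ hK hq hχ hβ hβq hz
  have h := Literature.Analysis.Complex.norm_iteratedDeriv_two_le_of_forall_mem_ball hR hd hM
  refine h.trans (le_of_eq ?_)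
  field_simp
  ring

end ZetaLsq

/-! ### The residue factor `M(z) = ζ(1+z−β)·L(1+z,χ)·L(1+z−β,χ)² = A(z)·L(1+z,χ)` -/

section ResFactor

variable {q : ℕ} [NeZero q] (χ : DirichletCharacter ℂ q)

/-- Leibniz at order two (Mathlib `iteratedDeriv_mul`). [folklore] -/
private theorem iteratedDeriv_two_mul₁ {f g : ℂ → ℂ} {x : ℂ} (hf : ContDiffAt ℂ 2 f x)
    (hg : ContDiffAt ℂ 2 g x) :
    iteratedDeriv 2 (fun z => f z * g z) x =
      iteratedDeriv 2 f x * g x + 2 * deriv f x * deriv g x + f x * iteratedDeriv 2 g x := by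
  rw [iteratedDeriv_fun_mul hf hg]
  simp only [Finset.sum_range_succ, Finset.sum_range_zero, Nat.choose_zero_right,
    Nat.choose_one_right, Nat.choose_self, iteratedDeriv_zero, iteratedDeriv_one, Nat.cast_one,
    Nat.cast_ofNat, zero_add, Nat.sub_zero, Nat.reduceSub, show (2 : ℕ) - 2 = 0 from rfl]
  ring

/-- **The residue factor `M(z) = ζ(1+z−β)·L(1+z,χ)·L(1+z−β,χ)²`** (`χ ≠ 1`, `β ≠ 0`): `M` is analytic at
`0` (indeed holomorphic on `{z | z ≠ β}`), and with `A(z) = ζ(1+z−β)L(1+z−β,χ)²`: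
`M(0) = A(0)L(1,χ)`, `M′(0) = A′(0)L(1,χ) + A(0)L′(1,χ)`,
`M″(0) = A″(0)L(1,χ) + 2A′(0)L′(1,χ) + A(0)L″(1,χ)`. [cite: Zhang2022LandauSiegel, §16 p.94] -/
theorem resFactor_data (hχ1 : χ ≠ 1) {β : ℂ} (hβ : β ≠ 0) :
    DifferentiableOn ℂ
        (fun z : ℂ => riemannZeta (1 + z - β) * χ.LFunction (1 + z) * χ.LFunction (1 + z - β) ^ 2)
        {z : ℂ | z ≠ β} ∧
      AnalyticAt ℂ
        (fun z : ℂ => riemannZeta (1 + z - β) * χ.LFunction (1 + z) * χ.LFunction (1 + z - β) ^ 2) 0 ∧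
      (fun z : ℂ => riemannZeta (1 + z - β) * χ.LFunction (1 + z) * χ.LFunction (1 + z - β) ^ 2) 0 =
        (fun z : ℂ => riemannZeta (1 + z - β) * χ.LFunction (1 + z - β) ^ 2) 0 * χ.LFunction 1 ∧
      deriv (fun z : ℂ => riemannZeta (1 + z - β) * χ.LFunction (1 + z) * χ.LFunction (1 + z - β) ^ 2) 0 =
        deriv (fun z : ℂ => riemannZeta (1 + z - β) * χ.LFunction (1 + z - β) ^ 2) 0 * χ.LFunction 1 +
          (fun z : ℂ => riemannZeta (1 + z - β) * χ.LFunction (1 + z - β) ^ 2) 0 *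
            deriv χ.LFunction 1 ∧
      iteratedDeriv 2
          (fun z : ℂ => riemannZeta (1 + z - β) * χ.LFunction (1 + z) * χ.LFunction (1 + z - β) ^ 2) 0 =
        iteratedDeriv 2 (fun z : ℂ => riemannZeta (1 + z - β) * χ.LFunction (1 + z - β) ^ 2) 0 *
            χ.LFunction 1 +
          2 * deriv (fun z : ℂ => riemannZeta (1 + z - β) * χ.LFunction (1 + z - β) ^ 2) 0 *
            deriv χ.LFunction 1 +
          (fun z : ℂ => riemannZeta (1 + z - β) * χ.LFunction (1 + z - β) ^ 2) 0 *
            iteratedDeriv 2 χ.LFunction 1 := by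
  have hL := DirichletCharacter.differentiable_LFunction hχ1
  set A : ℂ → ℂ := fun z => riemannZeta (1 + z - β) * χ.LFunction (1 + z - β) ^ 2 with hAdef
  set Λ₁ : ℂ → ℂ := fun z => χ.LFunction (1 + z) with hΛdef
  obtain ⟨hAd, -, -⟩ := zetaLsq_data χ hχ1 hβ
  have hΛd : Differentiable ℂ Λ₁ := hL.comp ((differentiable_const _).add differentiable_id)
  have hM : (fun z : ℂ => riemannZeta (1 + z - β) * χ.LFunction (1 + z) * χ.LFunction (1 + z - β) ^ 2) =
      fun z => A z * Λ₁ z := by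
    funext z; simp only [hAdef, hΛdef]; ring
  have hopen : IsOpen {z : ℂ | z ≠ β} := isOpen_ne
  have h0mem : (0 : ℂ) ∈ {z : ℂ | z ≠ β} := by
    rw [Set.mem_setOf_eq]; exact fun h => hβ h.symm
  have hAa : AnalyticAt ℂ A 0 := hAd.analyticAt (hopen.mem_nhds h0mem)
  have hΛa : AnalyticAt ℂ Λ₁ 0 := hΛd.analyticAt 0
  have hAc : ContDiffAt ℂ 2 A 0 := hAa.contDiffAt
  have hΛc : ContDiffAt ℂ 2 Λ₁ 0 := hΛa.contDiffAt
  have hΛ0 : Λ₁ 0 = χ.LFunction 1 := by simp [hΛdef]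
  have hΛ1 : deriv Λ₁ 0 = deriv χ.LFunction 1 := by
    simp only [hΛdef]; rw [deriv_comp_const_add]; simp
  have hΛ2 : iteratedDeriv 2 Λ₁ 0 = iteratedDeriv 2 χ.LFunction 1 := by
    simp only [hΛdef]; rw [iteratedDeriv_comp_const_add]; simp
  rw [hM]
  refine ⟨?_, hAa.mul hΛa, ?_, ?_, ?_⟩
  · exact hAd.mul hΛd.differentiableOn
  · simp only [hΛ0]
  · rw [deriv_fun_mul hAa.differentiableAt hΛa.differentiableAt, hΛ0, hΛ1]
  · rw [iteratedDeriv_two_mul₁ hAc hΛc, hΛ0, hΛ1, hΛ2]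

end ResFactor

/-! ### The bounds for `β = βⱼ` under (A), for all large `D` -/

section Bounds

/-- `M ≤ 𝓛` once `D ≥ ⌈e^M⌉`. [cite: Zhang2022LandauSiegel, §2 (2.1)] -/
private theorem le_ell_of_ceil_exp_le₁₆ {M : ℝ} {D : ℕ} (hD : ⌈Real.exp M⌉₊ ≤ D) : M ≤ ell D := by
  have h : Real.exp M ≤ D := le_trans (Nat.le_ceil _) (by exact_mod_cast hD)
  exact (Real.le_log_iff_exp_le (lt_of_lt_of_le (Real.exp_pos _) h)).mpr h

/-- **`|βⱼ| ≥ α/2`** for `|θ| ≤ 1/14` (`θ = c′α𝓛`; `β₁ = iα(1−5θ)`, `β₂ = 2iα(1+θ)`, `β₃ = 3iα(1−θ)`),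
`j ∈ {1,2,3}` — the pole of `ζ(1+z−βⱼ)` stays at distance `≥ α/2` from `z = 0`.
[cite: Zhang2022LandauSiegel, §2 (2.13)] -/
theorem betaJ_norm_ge (c' : ℝ) {D : ℕ} (hα : 0 < alpha D) (hθ : |c' * alpha D * ell D| ≤ 1 / 14)
    {j : ℕ} (hj : j ∈ ({1, 2, 3} : Finset ℕ)) :
    alpha D / 2 ≤ ‖betaJ c' D j‖ := by
  obtain ⟨e1, e2, e3⟩ := Ded1524.beta_eq_b_mul_I c' D
  have hθ' := abs_le.mp hθ
  have nI : ∀ p : ℝ, ‖(p : ℂ) * I‖ = |p| := fun p => by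
    rw [norm_mul, Complex.norm_I, mul_one, Complex.norm_real, Real.norm_eq_abs]
  have hv : betaJ c' D 1 = beta1 c' D ∧ betaJ c' D 2 = beta2 c' D ∧ betaJ c' D 3 = beta3 c' D := by
    simp [betaJ]
  obtain ⟨b1v, b2v, b3v⟩ := hv
  simp only [Finset.mem_insert, Finset.mem_singleton] at hj
  rcases hj with rfl | rfl | rfl
  · rw [b1v, e1, nI, b1]
    rw [show alpha D * (1 - 5 * c' * alpha D * ell D) = alpha D * (1 - 5 * (c' * alpha D * ell D))
      by ring, abs_mul, abs_of_pos hα]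
    have : 1 / 2 ≤ |1 - 5 * (c' * alpha D * ell D)| :=
      le_trans (by linarith) (le_abs_self _)
    nlinarith
  · rw [b2v, e2, nI, b2]
    rw [show 2 * alpha D * (1 + c' * alpha D * ell D) = alpha D * (2 * (1 + c' * alpha D * ell D))
      by ring, abs_mul, abs_of_pos hα]
    have : 1 / 2 ≤ |2 * (1 + c' * alpha D * ell D)| :=
      le_trans (by linarith) (le_abs_self _)
    nlinarith
  · rw [b3v, e3, nI, b3]
    rw [show 3 * alpha D * (1 - c' * alpha D * ell D) = alpha D * (3 * (1 - c' * alpha D * ell D))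
      by ring, abs_mul, abs_of_pos hα]
    have : 1 / 2 ≤ |3 * (1 - c' * alpha D * ell D)| :=
      le_trans (by linarith) (le_abs_self _)
    nlinarith

/-- Real bookkeeping, `A`-level: the bound for `‖A′(0) − L′(1,χ)²‖`. [folklore] -/
private theorem bookkeeping_A1 {α L A K ℓ e2 X Yl2 ll R₀ R₁ : ℝ}
    (hα : 0 < α) (_hα1 : α ≤ 1) (hL : 1 ≤ L) (hA : 1 ≤ A) (hK : 1 ≤ K) (hℓ : 0 ≤ ℓ)
    (hαL : α * L ^ 6 ≤ 4) (hR₀ : 0 ≤ R₀) (hR₁ : 0 ≤ R₁)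
    (hR₀L : R₀ ≤ 32 * A * L ^ 3) (hR₁L : R₁ ≤ 16 * A * L ^ 3)
    (he2 : e2 ≤ 5 * R₁ * α) (he2' : 0 ≤ e2) (hX : X ≤ 52 * R₀ * α) (hX' : 0 ≤ X)
    (hYl2 : Yl2 ≤ 50 * α * (1 + ℓ) ^ 2) (hll : ll ≤ 5 * α * (1 + ℓ) ^ 2) :
    2 * ℓ * e2 + 2 * X * e2 + X ^ 2 + 2 * K * Yl2 + 2 * K * ll ≤
      (2 * 10 ^ 7 * A ^ 2 + 110 * K) * α * L ^ 3 * (1 + ℓ) ^ 2 := by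
  have hL3 : 1 ≤ L ^ 3 := one_le_pow₀ hL
  have hαL6 : α ^ 2 * L ^ 6 ≤ 4 * α := by nlinarith
  -- the five terms
  have t1 : 2 * ℓ * e2 ≤ 160 * A * α * L ^ 3 * (1 + ℓ) ^ 2 := by
    calc 2 * ℓ * e2 ≤ 2 * ℓ * (5 * R₁ * α) := by gcongr
      _ ≤ 2 * ℓ * (5 * (16 * A * L ^ 3) * α) := by gcongr
      _ = 160 * A * α * L ^ 3 * ℓ := by ring
      _ ≤ 160 * A * α * L ^ 3 * (1 + ℓ) ^ 2 := by
          gcongr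
          nlinarith
  have t2 : 2 * X * e2 ≤ 1100000 * A ^ 2 * α * L ^ 3 * (1 + ℓ) ^ 2 := by
    calc 2 * X * e2 ≤ 2 * (52 * R₀ * α) * (5 * R₁ * α) := by gcongr
      _ ≤ 2 * (52 * (32 * A * L ^ 3) * α) * (5 * (16 * A * L ^ 3) * α) := by gcongr
      _ = 266240 * A ^ 2 * (α ^ 2 * L ^ 6) := by ring
      _ ≤ 266240 * A ^ 2 * (4 * α) := by gcongr
      _ = 1064960 * A ^ 2 * α * 1 * 1 := by ring
      _ ≤ 1100000 * A ^ 2 * α * L ^ 3 * (1 + ℓ) ^ 2 := by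
          gcongr
          · norm_num
          · nlinarith
  have t3 : X ^ 2 ≤ 11100000 * A ^ 2 * α * L ^ 3 * (1 + ℓ) ^ 2 := by
    calc X ^ 2 ≤ (52 * R₀ * α) ^ 2 := pow_le_pow_left₀ hX' hX 2
      _ ≤ (52 * (32 * A * L ^ 3) * α) ^ 2 := by gcongr
      _ = 2768896 * A ^ 2 * (α ^ 2 * L ^ 6) := by ring
      _ ≤ 2768896 * A ^ 2 * (4 * α) := by gcongr
      _ = 11075584 * A ^ 2 * α * 1 * 1 := by ring
      _ ≤ 11100000 * A ^ 2 * α * L ^ 3 * (1 + ℓ) ^ 2 := by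
          gcongr
          · norm_num
          · nlinarith
  have t4 : 2 * K * Yl2 ≤ 100 * K * α * L ^ 3 * (1 + ℓ) ^ 2 := by
    calc 2 * K * Yl2 ≤ 2 * K * (50 * α * (1 + ℓ) ^ 2) := by gcongr
      _ = 100 * K * α * 1 * (1 + ℓ) ^ 2 := by ring
      _ ≤ 100 * K * α * L ^ 3 * (1 + ℓ) ^ 2 := by gcongr
  have t5 : 2 * K * ll ≤ 10 * K * α * L ^ 3 * (1 + ℓ) ^ 2 := by
    calc 2 * K * ll ≤ 2 * K * (5 * α * (1 + ℓ) ^ 2) := by gcongr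
      _ = 10 * K * α * 1 * (1 + ℓ) ^ 2 := by ring
      _ ≤ 10 * K * α * L ^ 3 * (1 + ℓ) ^ 2 := by gcongr
  have hpos : 0 ≤ α * L ^ 3 * (1 + ℓ) ^ 2 := by positivity
  nlinarith

/-- `e^{9/2} ≤ 91`. [folklore] -/
private theorem exp_nine_halves_le : Real.exp (9 / 2) ≤ 91 := by
  have h9 : Real.exp (9 / 2) ^ 2 = Real.exp 1 ^ 9 := by
    rw [← Real.exp_nat_mul, ← Real.exp_nat_mul]; norm_num
  have h2 : Real.exp 1 ^ 9 ≤ (2.7182818286 : ℝ) ^ 9 :=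
    pow_le_pow_left₀ (Real.exp_pos 1).le Real.exp_one_lt_d9.le 9
  have h3 : (2.7182818286 : ℝ) ^ 9 < 91 ^ 2 := by norm_num
  nlinarith [Real.exp_pos (9 / 2 : ℝ)]

/-- Real bookkeeping: the absorptions in `𝓛 = log D` used below (`α = π/𝓛⁹`, `A = e^{9/2} ≤ 91`,
`K ≥ 1` the `ζ₁`-constant, `C₁ = 2·10⁷A² + 110K`, `𝓛 ≥ 8`, `𝓛 ≥ 32C₁ + 10⁶A² + 4K`). [folklore] -/
private theorem real_facts {L A K C₁ α : ℝ} (hL8 : 8 ≤ L) (hA1 : 1 ≤ A) (hA91 : A ≤ 91)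
    (hK1 : 1 ≤ K) (hC₁0 : 0 ≤ C₁) (hbig : 32 * C₁ + 10 ^ 6 * A ^ 2 + 4 * K ≤ L)
    (hα : α = π / L ^ 9) :
    0 < α ∧ α ≤ 1 / 2 ∧ 5 * α ≤ 1 / (4 * L) ∧
      (16 * A * (1 + L) * L ^ 2) * (25 * α) ≤ 1 ∧ (8 * A * (1 + L) * L ^ 2) * (5 * α) ≤ 1 ∧
      α * L ^ 6 ≤ 4 ∧ K * α ≤ 1 ∧ 1 / L ^ 2022 ≤ α ^ 3 ∧ C₁ * α ^ 3 * L ^ 3 ≤ 1 ∧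
      5 * 10 ^ 5 * A ^ 2 * L ^ 4 / α * (1 / L ^ 2022) ≤ 2 * (α * L ^ 3) := by
  have hL1 : 1 ≤ L := by linarith
  have hL0 : 0 < L := by linarith
  have hA0 : 0 ≤ A := by linarith
  have hK0 : 0 ≤ K := by linarith
  have hπ4 : π ≤ 4 := by linarith [Real.pi_lt_d2]
  have hpow : ∀ n : ℕ, 1 ≤ n → L ≤ L ^ n := fun n hn => by
    calc L = L ^ 1 := (pow_one _).symm
      _ ≤ L ^ n := pow_le_pow_right₀ hL1 hn
  have hαpos : 0 < α := by rw [hα]; positivity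
  have hℓ6 : 800 * A * π ≤ L ^ 6 := by
    calc 800 * A * π ≤ 800 * (91 * 3.15) := by
          have : A * π ≤ 91 * 3.15 :=
            mul_le_mul hA91 Real.pi_lt_d2.le Real.pi_pos.le (by norm_num)
          linarith
      _ ≤ (8 : ℝ) ^ 6 := by norm_num
      _ ≤ L ^ 6 := pow_le_pow_left₀ (by norm_num) hL8 6
  have hR₀α : (16 * A * (1 + L) * L ^ 2) * (25 * α) ≤ 1 := by
    rw [hα]
    have e : 16 * A * (1 + L) * L ^ 2 * (25 * (π / L ^ 9)) =
        (400 * A * π * ((1 + L) * L ^ 2)) / L ^ 9 := by ring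
    rw [e, div_le_one (by positivity)]
    calc 400 * A * π * ((1 + L) * L ^ 2) ≤ 400 * A * π * (2 * L * L ^ 2) := by
          gcongr; linarith
      _ = (800 * A * π) * L ^ 3 := by ring
      _ ≤ L ^ 6 * L ^ 3 := by gcongr
      _ = L ^ 9 := by ring
  refine ⟨hαpos, ?_, ?_, hR₀α, ?_, ?_, ?_, ?_, ?_, ?_⟩
  · -- `α ≤ 1/2`
    rw [hα, div_le_div_iff₀ (by positivity) (by norm_num)]
    have h9 := hpow 9 (by norm_num)
    linarith
  · -- `5α ≤ 1/(4L)`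
    rw [hα, show 5 * (π / L ^ 9) = 5 * π / L ^ 9 by ring,
      div_le_div_iff₀ (by positivity) (by positivity)]
    have h8 : (64 : ℝ) ≤ L ^ 8 := by
      calc (64 : ℝ) ≤ 8 ^ 8 := by norm_num
        _ ≤ L ^ 8 := pow_le_pow_left₀ (by norm_num) hL8 8
    calc 5 * π * (4 * L) = 20 * π * L := by ring
      _ ≤ 64 * L := by nlinarith [Real.pi_lt_d2]
      _ ≤ L ^ 8 * L := by gcongr
      _ = 1 * L ^ 9 := by ring
  · -- `R₁·5α ≤ 1`
    refine le_trans ?_ hR₀α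
    have h0 : 0 ≤ A * (1 + L) * L ^ 2 * α := by positivity
    nlinarith
  · -- `α L⁶ ≤ 4`
    rw [hα]
    have e : π / L ^ 9 * L ^ 6 = π / L ^ 3 := by field_simp
    rw [e, div_le_iff₀ (by positivity)]
    have : (1 : ℝ) ≤ L ^ 3 := one_le_pow₀ hL1
    nlinarith
  · -- `K α ≤ 1`
    rw [hα, show K * (π / L ^ 9) = K * π / L ^ 9 by ring, div_le_one (by positivity)]
    have h4K : 4 * K ≤ L := by nlinarith
    calc K * π ≤ K * 4 := by gcongr
      _ = 4 * K := by ring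
      _ ≤ L := h4K
      _ ≤ L ^ 9 := hpow 9 (by norm_num)
  · -- `1/L^2022 ≤ α³`
    rw [hα, div_pow, div_le_div_iff₀ (by positivity) (by positivity), one_mul]
    have h27 : (L ^ 9) ^ 3 = L ^ 27 := by ring
    rw [h27]
    calc L ^ 27 = L ^ 27 * 1 := (mul_one _).symm
      _ ≤ L ^ 2022 * π ^ 3 := by
          refine mul_le_mul (pow_le_pow_right₀ hL1 (by norm_num)) ?_ zero_le_one (by positivity)
          have h3 : (3 : ℝ) ^ 3 ≤ π ^ 3 := pow_le_pow_left₀ (by norm_num) Real.pi_gt_three.le 3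
          linarith
      _ = π ^ 3 * L ^ 2022 := mul_comm _ _
  · -- `C₁ α³ L³ ≤ 1`
    rw [hα, div_pow]
    have e : C₁ * (π ^ 3 / (L ^ 9) ^ 3) * L ^ 3 = C₁ * π ^ 3 / L ^ 24 := by
      field_simp
    rw [e, div_le_one (by positivity)]
    have hbig' : 32 * C₁ ≤ L := by nlinarith
    have hπ3 : π ^ 3 ≤ 32 := by
      have h := pow_le_pow_left₀ Real.pi_pos.le Real.pi_lt_d2.le 3
      have : (3.15 : ℝ) ^ 3 ≤ 32 := by norm_num
      linarith
    calc C₁ * π ^ 3 ≤ C₁ * 32 := by gcongr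
      _ = 32 * C₁ := by ring
      _ ≤ L := hbig'
      _ ≤ L ^ 24 := hpow 24 (by norm_num)
  · -- `5·10⁵A²L⁴/α · L⁻²⁰²² ≤ 2αL³`
    rw [hα]
    have e : 5 * 10 ^ 5 * A ^ 2 * L ^ 4 / (π / L ^ 9) * (1 / L ^ 2022) =
        5 * 10 ^ 5 * A ^ 2 / (π * L ^ 2009) := by
      rw [div_div_eq_mul_div]
      field_simp
    have e2 : 2 * (π / L ^ 9 * L ^ 3) = 2 * π ^ 2 * L ^ 2003 / (π * L ^ 2009) := by
      field_simp
    rw [e, e2, div_le_div_iff_of_pos_right (by positivity)]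
    have hbig' : 10 ^ 6 * A ^ 2 ≤ L := by nlinarith
    calc 5 * 10 ^ 5 * A ^ 2 ≤ 10 ^ 6 * A ^ 2 := by nlinarith
      _ ≤ L := hbig'
      _ ≤ L ^ 2003 := hpow 2003 (by norm_num)
      _ = 1 * L ^ 2003 := (one_mul _).symm
      _ ≤ (2 * π ^ 2) * L ^ 2003 := by gcongr; nlinarith [Real.pi_gt_three]
      _ = 2 * π ^ 2 * L ^ 2003 := by ring

/-- Real bookkeeping, `M′(0)`-level. [folklore] -/
private theorem bookkeeping_M1 {α W ℓ a1f a0 l0 C₁ : ℝ} (hα : 0 < α) (hℓ : 0 ≤ ℓ)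
    (_ha1f0 : 0 ≤ a1f) (_ha00 : 0 ≤ a0) (hl00 : 0 ≤ l0) (hW0 : 0 ≤ W)
    (hl0 : l0 ≤ α ^ 3) (hα1 : α ≤ 1) (ha1f : a1f ≤ ℓ ^ 2 + W * (1 + ℓ) ^ 2) (hW : W * α ^ 2 ≤ 1)
    (ha0 : a0 ≤ 75 * α * (1 + ℓ) ^ 2) (hC : 77 ≤ 2 * C₁) :
    a1f * l0 + a0 * ℓ ≤ 2 * C₁ * α * (1 + ℓ) ^ 3 := by
  have h1ℓ : (1 : ℝ) ≤ 1 + ℓ := by linarith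
  have hp2 : 0 ≤ (1 + ℓ) ^ 2 := by positivity
  have hp3 : (1 + ℓ) ^ 2 ≤ (1 + ℓ) ^ 3 := pow_le_pow_right₀ h1ℓ (by norm_num)
  have hα2 : α ^ 2 ≤ 1 := by nlinarith
  have t1 : a1f * l0 ≤ 2 * α * (1 + ℓ) ^ 3 := by
    calc a1f * l0 ≤ (ℓ ^ 2 + W * (1 + ℓ) ^ 2) * α ^ 3 := by gcongr
      _ = α * (ℓ ^ 2 * α ^ 2 + (W * α ^ 2) * (1 + ℓ) ^ 2) := by ring
      _ ≤ α * ((1 + ℓ) ^ 2 * 1 + 1 * (1 + ℓ) ^ 2) := by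
          gcongr
          nlinarith
      _ = 2 * α * (1 + ℓ) ^ 2 := by ring
      _ ≤ 2 * α * (1 + ℓ) ^ 3 := by gcongr
  have t2 : a0 * ℓ ≤ 75 * α * (1 + ℓ) ^ 3 := by
    calc a0 * ℓ ≤ (75 * α * (1 + ℓ) ^ 2) * (1 + ℓ) := by gcongr; linarith
      _ = 75 * α * (1 + ℓ) ^ 3 := by ring
  have hpos : 0 ≤ α * (1 + ℓ) ^ 3 := by positivity
  nlinarith

/-- Real bookkeeping, `M″(0)`-level. [folklore] -/
private theorem bookkeeping_M2 {α L3 ℓ x a1n a0 L2 A C₁ : ℝ} (hα : 0 < α) (hL3 : 0 ≤ L3) (hℓ : 0 ≤ ℓ)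
    (_ha00 : 0 ≤ a0) (hL20 : 0 ≤ L2) (hA : 1 ≤ A)
    (hx : x ≤ α * L3) (ha1n : a1n ≤ C₁ * α * L3 * (1 + ℓ) ^ 2) (ha0 : a0 ≤ 75 * α * (1 + ℓ) ^ 2)
    (hL2 : L2 ≤ 128 * A * L3) (hC : 1 + 4800 * A ≤ C₁) :
    x + a1n * ℓ + a0 * L2 / 2 ≤ 2 * C₁ * α * L3 * (1 + ℓ) ^ 3 := by
  have h1ℓ : (1 : ℝ) ≤ 1 + ℓ := by linarith
  have hp3 : (1 : ℝ) ≤ (1 + ℓ) ^ 3 := one_le_pow₀ h1ℓ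
  have hp23 : (1 + ℓ) ^ 2 ≤ (1 + ℓ) ^ 3 := pow_le_pow_right₀ h1ℓ (by norm_num)
  have hC0 : 0 ≤ C₁ := by linarith
  have t1 : x ≤ α * L3 * (1 + ℓ) ^ 3 := by
    calc x ≤ α * L3 * 1 := by rw [mul_one]; exact hx
      _ ≤ α * L3 * (1 + ℓ) ^ 3 := by gcongr
  have t2 : a1n * ℓ ≤ C₁ * α * L3 * (1 + ℓ) ^ 3 := by
    calc a1n * ℓ ≤ (C₁ * α * L3 * (1 + ℓ) ^ 2) * (1 + ℓ) := by
          refine mul_le_mul ha1n (by linarith) hℓ (by positivity)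
      _ = C₁ * α * L3 * (1 + ℓ) ^ 3 := by ring
  have t3 : a0 * L2 / 2 ≤ 4800 * A * (α * L3 * (1 + ℓ) ^ 3) := by
    calc a0 * L2 / 2 ≤ (75 * α * (1 + ℓ) ^ 2) * (128 * A * L3) / 2 := by gcongr
      _ = 4800 * A * (α * L3 * (1 + ℓ) ^ 2) := by ring
      _ ≤ 4800 * A * (α * L3 * (1 + ℓ) ^ 3) := by gcongr
  have hpos : 0 ≤ α * L3 * (1 + ℓ) ^ 3 := by positivity
  nlinarith

open scoped Classical in
/-- **The Taylor data of the §16 residue factor at `0`, under (A), for all large `D`.** There is an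
absolute `C ≥ 0` such that for all large `D`, under (A), for `j ∈ {1,2,3}`, with `βⱼ` of (2.13) and
`M(z) = ζ(1+z−βⱼ)·L(1+z,χ)·L(1+z−βⱼ,χ)²`, `ℓ = ‖L′(1,χ)‖`: `M` is analytic at `0` and
`‖M(0)‖ ≤ Cα⁴(1+ℓ)²`, `‖M′(0)‖ ≤ Cα(1+ℓ)³`, `‖½M″(0) − L′(1,χ)³‖ ≤ Cα𝓛³(1+ℓ)³`
(from `ζ(1−β) = −1/β + O(1)`, `ζ′(1−β) = −1/β² + O(1/|β|)`, `L(1−β) = L(1) − βL′(1) + O(𝓛³α²)`,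
`|L(1)| < 𝓛⁻²⁰²²`, `L′(1−β) = L′(1) + O(𝓛³α)`, `α/2 ≤ |β| < 5α`: the main term `L′³` is
`(−L′² + 2L′²)·L′`). This is the character-side input of the residue at the triple pole `s = 0` of the
repaired §16 integrand (`Typed.Section16B.integrand16_u040R`). [cite: Zhang2022LandauSiegel, §16 p.94] -/
theorem resFactor_bounds (c' : ℝ) : ∃ C : ℝ, 0 ≤ C ∧
    ForAllLarge fun D _ χ => AssumptionA D χ → ∀ j ∈ ({1, 2, 3} : Finset ℕ),
      AnalyticAt ℂ (fun z : ℂ => riemannZeta (1 + z - betaJ c' D j) * χ.LFunction (1 + z) *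
          χ.LFunction (1 + z - betaJ c' D j) ^ 2) 0 ∧
      ‖(fun z : ℂ => riemannZeta (1 + z - betaJ c' D j) * χ.LFunction (1 + z) *
          χ.LFunction (1 + z - betaJ c' D j) ^ 2) 0‖ ≤
        C * alpha D ^ 4 * (1 + ‖deriv χ.LFunction 1‖) ^ 2 ∧
      ‖deriv (fun z : ℂ => riemannZeta (1 + z - betaJ c' D j) * χ.LFunction (1 + z) *
          χ.LFunction (1 + z - betaJ c' D j) ^ 2) 0‖ ≤
        C * alpha D * (1 + ‖deriv χ.LFunction 1‖) ^ 3 ∧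
      ‖iteratedDeriv 2 (fun z : ℂ => riemannZeta (1 + z - betaJ c' D j) * χ.LFunction (1 + z) *
          χ.LFunction (1 + z - betaJ c' D j) ^ 2) 0 / 2 - deriv χ.LFunction 1 ^ 3‖ ≤
        C * alpha D * ell D ^ 3 * (1 + ‖deriv χ.LFunction 1‖) ^ 3 := by
  obtain ⟨K, hK1, hK⟩ := exists_zeta1_near_one_consts
  set A : ℝ := Real.exp (9 / 2) with hAdef
  have hA1 : 1 ≤ A := Real.one_le_exp (by norm_num)
  have hA0 : 0 ≤ A := by linarith
  have hA91 : A ≤ 91 := exp_nine_halves_le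
  have hK0 : 0 ≤ K := by linarith
  set C₁ : ℝ := 2 * 10 ^ 7 * A ^ 2 + 110 * K with hC₁
  have hC₁0 : 0 ≤ C₁ := by positivity
  have hC77 : (77 : ℝ) ≤ 2 * C₁ := by simp only [hC₁]; nlinarith [hA1, hK1]
  have hC4800 : 1 + 4800 * A ≤ C₁ := by simp only [hC₁]; nlinarith [hA1, hK1]
  refine ⟨2 * C₁, by positivity, ?_⟩
  set Mbig : ℝ := 32 * C₁ + 10 ^ 6 * A ^ 2 + 4 * K with hMbig
  set M : ℝ := max (max 8 (14 * |c'| * π + 1)) Mbig with hMdef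
  refine ForAllLarge.of_le ⌈Real.exp M⌉₊ fun D _ χ hD hq hp hA j hj => ?_
  have hMℓ : M ≤ ell D := le_ell_of_ceil_exp_le₁₆ hD
  have hℓ8 : 8 ≤ ell D := ((le_max_left _ _).trans (le_max_left _ _)).trans hMℓ
  have hℓc : 14 * |c'| * π + 1 ≤ ell D := ((le_max_right _ _).trans (le_max_left _ _)).trans hMℓ
  have hℓbig : Mbig ≤ ell D := (le_max_right _ _).trans hMℓ
  have hℓ3 : 3 ≤ ell D := by linarith only [hℓ8]
  have hℓ1 : 1 ≤ ell D := by linarith only [hℓ8]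
  have hℓ0 : 0 < ell D := by linarith only [hℓ8]
  have hD2 : 2 ≤ D := by
    by_contra hlt
    have : D ≤ 1 := by omega
    have : (D : ℝ) ≤ 1 := by exact_mod_cast this
    have : ell D ≤ 0 := by
      rw [ell]; exact Real.log_nonpos (Nat.cast_nonneg _) this
    linarith only [this, hℓ8]
  have hχ1 := Lemma31.ne_one_of_isPrimitive χ hD2 hp
  -- `α` and the real facts
  have hα : alpha D = π / ell D ^ 9 := by rw [alpha, bigP, Real.log_exp]
  obtain ⟨hαpos, hαhalf, h5α, hR₀α, hR₁α, hαL6, hKα, hL2022, hC₁α, habs⟩ :=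
    real_facts hℓ8 hA1 hA91 hK1 hC₁0 hℓbig hα
  have hα1 : alpha D ≤ 1 := by linarith only [hαhalf]
  have hθ : |c' * alpha D * ell D| ≤ 1 / 14 := by
    have hα1' : alpha D * ell D = π / ell D ^ 8 := by rw [hα]; field_simp
    rw [abs_mul, abs_mul, abs_of_pos hαpos, abs_of_pos hℓ0, mul_assoc, hα1',
      show |c'| * (π / ell D ^ 8) = |c'| * π / ell D ^ 8 by ring,
      div_le_div_iff₀ (by positivity) (by norm_num)]
    have h8 : ell D ≤ ell D ^ 8 := by
      calc ell D = ell D ^ 1 := (pow_one _).symm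
        _ ≤ ell D ^ 8 := pow_le_pow_right₀ hℓ1 (by norm_num)
    nlinarith only [abs_nonneg c', Real.pi_pos, h8, hℓc]
  obtain ⟨hβ5, -⟩ := Ded1524.betaJ_norm_lt c' hαpos hθ hj
  have hβlo := betaJ_norm_ge c' hαpos hθ hj
  set β := betaJ c' D j with hβdef
  have hb : 0 < ‖β‖ := lt_of_lt_of_le (by positivity) hβlo
  have hβ0 : β ≠ 0 := norm_pos_iff.mp hb
  have hβ4L : ‖β‖ ≤ 1 / (4 * ell D) := hβ5.le.trans h5α
  have hβ4 : ‖β‖ ≤ 1 / 4 := hβ4L.trans (by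
    rw [div_le_div_iff₀ (by positivity) (by norm_num)]; linarith only [hℓ1])
  have hℓD : (3 : ℝ) ≤ Real.log D := hℓ3
  have h0L : ‖(0 : ℂ)‖ ≤ 1 / (4 * Real.log D) := by rw [norm_zero]; positivity
  -- the pointwise `L`-lemmas at `q = D`
  have hT := U055.norm_LFunction_taylor_two_le χ hℓD hp hβ4L
  have hS := U055.norm_deriv_LFunction_sub_le χ hℓD hp hβ4L
  have hI0 := U055.norm_iteratedDeriv_two_LFunction_le χ hℓD hp h0L
  rw [sub_zero] at hI0
  change ‖χ.LFunction (1 - β) - χ.LFunction 1 + β * deriv χ.LFunction 1‖ ≤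
    16 * A * (1 + ell D) * ell D ^ 2 * ‖β‖ ^ 2 at hT
  change ‖deriv χ.LFunction (1 - β) - deriv χ.LFunction 1‖ ≤
    8 * A * (1 + ell D) * ell D ^ 2 * ‖β‖ at hS
  change ‖iteratedDeriv 2 χ.LFunction 1‖ ≤ 64 * A * (1 + ell D) * ell D ^ 2 at hI0
  -- the pointwise `A`-lemmas
  obtain ⟨hA0le, hA1le⟩ := norm_zetaLsq_data_le χ hK hχ1 hβ0 hβ4
  have hA2le := norm_iteratedDeriv_two_zetaLsq_le χ hK hℓD hp hβ0 hβ4L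
  change ‖iteratedDeriv 2 (fun z : ℂ => riemannZeta (1 + z - β) * χ.LFunction (1 + z - β) ^ 2) 0‖ ≤
      32 * ((2 / ‖β‖ + K) *
        (‖χ.LFunction 1‖ + 12 * A * (1 + ell D) * ell D * ‖β‖) ^ 2) / ‖β‖ ^ 2 at hA2le
  obtain ⟨-, hMan, hM0, hM1, hM2⟩ := resFactor_data χ hχ1 hβ0
  -- abbreviations (reals)
  set ℓ := ‖deriv χ.LFunction 1‖ with hℓ'
  set l0 := ‖χ.LFunction 1‖ with hl0def
  set b := ‖β‖ with hbdef'
  set e1 := ‖χ.LFunction (1 - β) + β * deriv χ.LFunction 1‖ with he1def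
  set e2 := ‖deriv χ.LFunction (1 - β) - deriv χ.LFunction 1‖ with he2def
  set lam0 := ‖χ.LFunction (1 - β)‖ with hlam0def
  set lam1 := ‖deriv χ.LFunction (1 - β)‖ with hlam1def
  set R₀ : ℝ := 16 * A * (1 + ell D) * ell D ^ 2 with hR₀
  set R₁ : ℝ := 8 * A * (1 + ell D) * ell D ^ 2 with hR₁
  set Az : ℂ → ℂ := fun z : ℂ => riemannZeta (1 + z - β) * χ.LFunction (1 + z - β) ^ 2 with hAzdef
  have hℓnn : 0 ≤ ℓ := norm_nonneg _
  -- sizes of the parameters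
  have h1ℓ : 1 + ell D ≤ 2 * ell D := by linarith only [hℓ1]
  have hR₀L : R₀ ≤ 32 * A * ell D ^ 3 := by
    calc R₀ = 16 * A * (1 + ell D) * ell D ^ 2 := rfl
      _ ≤ 16 * A * (2 * ell D) * ell D ^ 2 := by gcongr
      _ = 32 * A * ell D ^ 3 := by ring
  have hR₁L : R₁ ≤ 16 * A * ell D ^ 3 := by
    calc R₁ = 8 * A * (1 + ell D) * ell D ^ 2 := rfl
      _ ≤ 8 * A * (2 * ell D) * ell D ^ 2 := by gcongr
      _ = 16 * A * ell D ^ 3 := by ring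
  have hR₂L : 64 * A * (1 + ell D) * ell D ^ 2 ≤ 128 * A * ell D ^ 3 := by
    calc 64 * A * (1 + ell D) * ell D ^ 2 ≤ 64 * A * (2 * ell D) * ell D ^ 2 := by gcongr
      _ = 128 * A * ell D ^ 3 := by ring
  have hR₀1 : 1 ≤ R₀ := by
    have h2 : (1 : ℝ) ≤ ell D ^ 2 := one_le_pow₀ hℓ1
    calc (1 : ℝ) = 1 * 1 * (1 + 0) * 1 := by ring
      _ ≤ 16 * A * (1 + ell D) * ell D ^ 2 := by
          gcongr
          · norm_num
  -- (A): `l0 ≤ α³ ≤ α`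
  have hl0 : l0 < 1 / ell D ^ 2022 := hA
  have hl0α3 : l0 ≤ alpha D ^ 3 := hl0.le.trans hL2022
  have hl0α : l0 ≤ alpha D := by
    calc l0 ≤ alpha D ^ 3 := hl0α3
      _ ≤ alpha D ^ 1 := pow_le_pow_of_le_one hαpos.le hα1 (by norm_num)
      _ = alpha D := pow_one _
  -- `e1 ≤ l0 + R₀ b²`, `e2 ≤ R₁ b`, `λ0 ≤ e1 + b ℓ`, `λ1 ≤ ℓ + e2`
  have he1 : e1 ≤ l0 + R₀ * b ^ 2 := by
    calc e1 = ‖(χ.LFunction (1 - β) - χ.LFunction 1 + β * deriv χ.LFunction 1) + χ.LFunction 1‖ := by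
          simp only [he1def]; congr 1; ring
      _ ≤ ‖χ.LFunction (1 - β) - χ.LFunction 1 + β * deriv χ.LFunction 1‖ + l0 := norm_add_le _ _
      _ ≤ R₀ * b ^ 2 + l0 := by gcongr
      _ = l0 + R₀ * b ^ 2 := add_comm _ _
  have he2 : e2 ≤ R₁ * b := hS
  have hlam0 : lam0 ≤ e1 + b * ℓ := by
    calc lam0 = ‖(χ.LFunction (1 - β) + β * deriv χ.LFunction 1) - β * deriv χ.LFunction 1‖ := by
          simp only [hlam0def]; congr 1; ring
      _ ≤ e1 + ‖β * deriv χ.LFunction 1‖ := norm_sub_le _ _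
      _ = e1 + b * ℓ := by rw [norm_mul]
  have hlam1 : lam1 ≤ ℓ + e2 := by
    calc lam1 = ‖deriv χ.LFunction 1 + (deriv χ.LFunction (1 - β) - deriv χ.LFunction 1)‖ := by
          simp only [hlam1def]; congr 1; ring
      _ ≤ ℓ + e2 := norm_add_le _ _
  -- numeric consequences
  have hb5 : b ≤ 5 * alpha D := hβ5.le
  have hb2 : b⁻¹ ≤ 2 / alpha D := by
    rw [inv_eq_one_div, div_le_div_iff₀ hb hαpos]; linarith only [hβlo]
  have he2' : e2 ≤ 5 * R₁ * alpha D := by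
    calc e2 ≤ R₁ * b := he2
      _ ≤ R₁ * (5 * alpha D) := by gcongr
      _ = 5 * R₁ * alpha D := by ring
  have he2one : e2 ≤ 1 := by
    calc e2 ≤ 5 * R₁ * alpha D := he2'
      _ = R₁ * (5 * alpha D) := by ring
      _ ≤ 1 := hR₁α
  have he1' : e1 ≤ 26 * R₀ * alpha D ^ 2 := by
    calc e1 ≤ l0 + R₀ * b ^ 2 := he1
      _ ≤ alpha D ^ 3 + R₀ * (5 * alpha D) ^ 2 := by gcongr
      _ = alpha D ^ 2 * (alpha D + 25 * R₀) := by ring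
      _ ≤ alpha D ^ 2 * (1 * R₀ + 25 * R₀) := by gcongr; linarith only [hα1, hR₀1]
      _ = 26 * R₀ * alpha D ^ 2 := by ring
  have he1'' : e1 ≤ 2 * alpha D := by
    calc e1 ≤ 26 * R₀ * alpha D ^ 2 := he1'
      _ = (26 / 25) * (R₀ * (25 * alpha D)) * alpha D := by ring
      _ ≤ (26 / 25) * 1 * alpha D := by gcongr
      _ ≤ 2 * alpha D := by linarith only [hαpos]
  have hlam0' : lam0 ≤ 5 * alpha D * (1 + ℓ) := by
    calc lam0 ≤ e1 + b * ℓ := hlam0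
      _ ≤ 2 * alpha D + 5 * alpha D * ℓ := by gcongr
      _ ≤ 5 * alpha D * (1 + ℓ) := by
          have e : 5 * alpha D * (1 + ℓ) = 5 * alpha D + 5 * alpha D * ℓ := by ring
          rw [e]; linarith only [hαpos]
  have hlam1' : lam1 ≤ 1 + ℓ := by linarith only [hlam1, he2one]
  have hX : e1 * b⁻¹ ≤ 52 * R₀ * alpha D := by
    calc e1 * b⁻¹ ≤ (26 * R₀ * alpha D ^ 2) * (2 / alpha D) := by gcongr
      _ = 52 * R₀ * alpha D := by field_simp; ring
  have hYl2 : b⁻¹ * lam0 ^ 2 ≤ 50 * alpha D * (1 + ℓ) ^ 2 := by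
    calc b⁻¹ * lam0 ^ 2 ≤ (2 / alpha D) * (5 * alpha D * (1 + ℓ)) ^ 2 := by gcongr
      _ = 50 * alpha D * (1 + ℓ) ^ 2 := by field_simp; ring
  have hll : lam0 * lam1 ≤ 5 * alpha D * (1 + ℓ) ^ 2 := by
    calc lam0 * lam1 ≤ (5 * alpha D * (1 + ℓ)) * (1 + ℓ) := by gcongr
      _ = 5 * alpha D * (1 + ℓ) ^ 2 := by ring
  -- `‖A(0)‖ ≤ 75 α (1+ℓ)²`
  have ha0 : ‖Az 0‖ ≤ 75 * alpha D * (1 + ℓ) ^ 2 := by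
    calc ‖Az 0‖ ≤ (b⁻¹ + K) * lam0 ^ 2 := hA0le
      _ = b⁻¹ * lam0 ^ 2 + K * lam0 ^ 2 := by ring
      _ ≤ 50 * alpha D * (1 + ℓ) ^ 2 + K * (5 * alpha D * (1 + ℓ)) ^ 2 := by gcongr
      _ = 50 * alpha D * (1 + ℓ) ^ 2 + 25 * (K * alpha D) * alpha D * (1 + ℓ) ^ 2 := by ring
      _ ≤ 50 * alpha D * (1 + ℓ) ^ 2 + 25 * 1 * alpha D * (1 + ℓ) ^ 2 := by gcongr
      _ = 75 * alpha D * (1 + ℓ) ^ 2 := by ring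
  -- `‖A′(0) − L′²‖ ≤ C₁ α 𝓛³ (1+ℓ)²`
  have ha1 : ‖deriv Az 0 - deriv χ.LFunction 1 ^ 2‖ ≤ C₁ * alpha D * ell D ^ 3 * (1 + ℓ) ^ 2 := by
    have hbk := bookkeeping_A1 (α := alpha D) (L := ell D) (A := A) (K := K) (ℓ := ℓ) (e2 := e2)
      (X := e1 * b⁻¹) (Yl2 := b⁻¹ * lam0 ^ 2) (ll := lam0 * lam1) (R₀ := R₀) (R₁ := R₁)
      hαpos hα1 hℓ1 hA1 hK1 hℓnn hαL6 (by positivity) (by positivity) hR₀L hR₁L he2'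
      (norm_nonneg _) hX (by positivity) hYl2 hll
    calc ‖deriv Az 0 - deriv χ.LFunction 1 ^ 2‖
        ≤ 2 * ℓ * e2 + 2 * e1 * e2 * b⁻¹ + e1 ^ 2 * b⁻¹ ^ 2 + 2 * K / b * lam0 ^ 2 +
            2 * K * lam0 * lam1 := hA1le
      _ = 2 * ℓ * e2 + 2 * (e1 * b⁻¹) * e2 + (e1 * b⁻¹) ^ 2 + 2 * K * (b⁻¹ * lam0 ^ 2) +
            2 * K * (lam0 * lam1) := by rw [div_eq_mul_inv]; ring
      _ ≤ C₁ * alpha D * ell D ^ 3 * (1 + ℓ) ^ 2 := hbk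
  -- `‖A′(0)‖ ≤ ℓ² + C₁ α 𝓛³ (1+ℓ)²`
  have ha1' : ‖deriv Az 0‖ ≤ ℓ ^ 2 + C₁ * alpha D * ell D ^ 3 * (1 + ℓ) ^ 2 := by
    calc ‖deriv Az 0‖ = ‖deriv χ.LFunction 1 ^ 2 + (deriv Az 0 - deriv χ.LFunction 1 ^ 2)‖ := by
          rw [add_sub_cancel]
      _ ≤ ‖deriv χ.LFunction 1 ^ 2‖ + ‖deriv Az 0 - deriv χ.LFunction 1 ^ 2‖ := norm_add_le _ _
      _ ≤ ℓ ^ 2 + C₁ * alpha D * ell D ^ 3 * (1 + ℓ) ^ 2 := by rw [norm_pow]; gcongr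
  -- `‖A″(0)‖ ≤ 5·10⁵ A² 𝓛⁴ / α`
  have ha2 : ‖iteratedDeriv 2 Az 0‖ ≤ 5 * 10 ^ 5 * A ^ 2 * ell D ^ 4 / alpha D := by
    have hl0b : l0 ≤ b := by
      have h3 : alpha D ^ 3 ≤ alpha D / 2 := by
        have h2 : alpha D ^ 2 ≤ 1 / 2 := by nlinarith only [hαhalf, hαpos]
        calc alpha D ^ 3 = alpha D * alpha D ^ 2 := by ring
          _ ≤ alpha D * (1 / 2) := by gcongr
          _ = alpha D / 2 := by ring
      exact hl0α3.trans (h3.trans hβlo)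
    have h12 : l0 + 12 * A * (1 + ell D) * ell D * b ≤ 25 * A * ell D ^ 2 * b := by
      calc l0 + 12 * A * (1 + ell D) * ell D * b ≤ b + 12 * A * (2 * ell D) * ell D * b := by gcongr
        _ = b * (1 + 24 * A * ell D ^ 2) := by ring
        _ ≤ b * (1 * A * ell D ^ 2 + 24 * A * ell D ^ 2) := by
            gcongr
            have : (1 : ℝ) ≤ ell D ^ 2 := one_le_pow₀ hℓ1
            nlinarith only [this, hA1]
        _ = 25 * A * ell D ^ 2 * b := by ring
    have hpos : 0 ≤ l0 + 12 * A * (1 + ell D) * ell D * b := by positivity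
    have hsq : (l0 + 12 * A * (1 + ell D) * ell D * b) ^ 2 ≤ (25 * A * ell D ^ 2 * b) ^ 2 :=
      pow_le_pow_left₀ hpos h12 2
    have hcK : 0 ≤ 2 / b + K := by positivity
    calc ‖iteratedDeriv 2 Az 0‖
        ≤ 32 * ((2 / b + K) * (l0 + 12 * A * (1 + ell D) * ell D * b) ^ 2) / b ^ 2 := hA2le
      _ ≤ 32 * ((2 / b + K) * (25 * A * ell D ^ 2 * b) ^ 2) / b ^ 2 := by
          gcongr 32 * (?_) / b ^ 2
          exact mul_le_mul_of_nonneg_left hsq hcK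
      _ = 20000 * A ^ 2 * ell D ^ 4 * (2 * b⁻¹ + K) := by field_simp; ring
      _ ≤ 20000 * A ^ 2 * ell D ^ 4 * (2 * (2 / alpha D) + 1 / alpha D) := by
          gcongr
          rw [le_div_iff₀ hαpos]; exact hKα
      _ = 10 ^ 5 * A ^ 2 * ell D ^ 4 / alpha D := by ring
      _ ≤ 5 * 10 ^ 5 * A ^ 2 * ell D ^ 4 / alpha D := by gcongr; norm_num
  -- `½‖A″(0)‖·l0 ≤ α𝓛³`
  have ha2l0 : ‖iteratedDeriv 2 Az 0‖ * l0 / 2 ≤ alpha D * ell D ^ 3 := by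
    have h1 : ‖iteratedDeriv 2 Az 0‖ * l0 ≤
        5 * 10 ^ 5 * A ^ 2 * ell D ^ 4 / alpha D * (1 / ell D ^ 2022) :=
      mul_le_mul ha2 hl0.le (norm_nonneg _) (by positivity)
    linarith only [h1, habs]
  -- assemble the three `M`-bounds
  refine ⟨hMan, ?_, ?_, ?_⟩
  · -- `‖M(0)‖ = ‖A(0)‖·l0 ≤ 75 α (1+ℓ)² · α³`
    rw [hM0, norm_mul]
    calc ‖Az 0‖ * l0 ≤ (75 * alpha D * (1 + ℓ) ^ 2) * alpha D ^ 3 :=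
          mul_le_mul ha0 hl0α3 (norm_nonneg _) (by positivity)
      _ = 75 * alpha D ^ 4 * (1 + ℓ) ^ 2 := by ring
      _ ≤ 2 * C₁ * alpha D ^ 4 * (1 + ℓ) ^ 2 := by gcongr; linarith only [hC77]
  · -- `‖M′(0)‖ ≤ ‖A′(0)‖·l0 + ‖A(0)‖·ℓ`
    rw [hM1]
    have hW : C₁ * alpha D * ell D ^ 3 * alpha D ^ 2 ≤ 1 := by
      calc C₁ * alpha D * ell D ^ 3 * alpha D ^ 2 = C₁ * alpha D ^ 3 * ell D ^ 3 := by ring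
        _ ≤ 1 := hC₁α
    calc ‖deriv Az 0 * χ.LFunction 1 + Az 0 * deriv χ.LFunction 1‖
        ≤ ‖deriv Az 0‖ * l0 + ‖Az 0‖ * ℓ := by
          refine (norm_add_le _ _).trans ?_
          rw [norm_mul, norm_mul]
      _ ≤ 2 * C₁ * alpha D * (1 + ℓ) ^ 3 :=
          bookkeeping_M1 (W := C₁ * alpha D * ell D ^ 3) hαpos hℓnn (norm_nonneg _) (norm_nonneg _)
            (norm_nonneg _) (by positivity) hl0α3 hα1 ha1' hW ha0 hC77
  · -- `½M″(0) − L′³ = ½A″(0)L(1) + (A′(0) − L′²)L′ + ½A(0)L″(1)`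
    rw [hM2]
    have e : (iteratedDeriv 2 Az 0 * χ.LFunction 1 + 2 * deriv Az 0 * deriv χ.LFunction 1 +
          Az 0 * iteratedDeriv 2 χ.LFunction 1) / 2 - deriv χ.LFunction 1 ^ 3 =
        iteratedDeriv 2 Az 0 * χ.LFunction 1 / 2 +
          (deriv Az 0 - deriv χ.LFunction 1 ^ 2) * deriv χ.LFunction 1 +
          Az 0 * iteratedDeriv 2 χ.LFunction 1 / 2 := by ring
    rw [e]
    calc _ ≤ ‖iteratedDeriv 2 Az 0 * χ.LFunction 1 / 2‖ +
          ‖(deriv Az 0 - deriv χ.LFunction 1 ^ 2) * deriv χ.LFunction 1‖ +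
          ‖Az 0 * iteratedDeriv 2 χ.LFunction 1 / 2‖ := norm_add₃_le
      _ = ‖iteratedDeriv 2 Az 0‖ * l0 / 2 + ‖deriv Az 0 - deriv χ.LFunction 1 ^ 2‖ * ℓ +
          ‖Az 0‖ * ‖iteratedDeriv 2 χ.LFunction 1‖ / 2 := by
          simp only [norm_div, norm_mul, Complex.norm_two]
          rfl
      _ ≤ 2 * C₁ * alpha D * ell D ^ 3 * (1 + ℓ) ^ 3 :=
          bookkeeping_M2 (A := A) hαpos (by positivity) hℓnn (norm_nonneg _) (norm_nonneg _) hA1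
            ha2l0 ha1 ha0 (hI0.trans hR₂L) hC4800

end Bounds

end Literature.NumberTheory.LFunctions.Zhang2022.U041
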